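import Literature.Probability.RandomPlanarGeometry.SAWStripTMTraces
import Mathlib.Algebra.BigOperators.Group.Finset.Piecewise
import Mathlib.Algebra.Order.BigOperators.Group.Finset
import HarnessLib

/-!
# The weighted count is a lower bound for the Kraft sum (soundness, part 14, final)

Topic `Literature/Probability/RandomPlanarGeometry` (soundness of `SAWStripTM.lean`, final part).
The fixed-point dynamic programme `dp l H r₀` processes the micro-steps as layers of
(signature, weight) pairs in a hash map. We prove by induction over the layers that every stored
weight is at most `2⁶⁴ · X u σ`, the total weight `Σ (5/13)^{#edges}` of the traces of length `u`
whose run reaches `σ` (rounding down only helps), and that the accumulator is at most `2⁶⁴` times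
the sum of `(5/13)^{#edges + 1}` over the accepted traces. With `decode_spec` (the decoded word is
an irreducible bridge of span `l`, not longer than `#edges + 1`) and `decode_inj` this gives

* **`kraft_ge`** : `∃ S, (∀ s ∈ S, IsIrrBridge s ∧ xEnd s = l) ∧ dp l H r₀ / 2⁶⁴ ≤ Σ_{s ∈ S} (5/13)^{|s|}`.

## References

* I. Jensen, J. Phys. A 37 (2004) 11521–11529, §2 (Kesten's bound from span-limited
  irreducible bridges), §2.1 (transfer matrices).
-/

open Finset
open scoped BigOperators

namespace Literature.Probability.RandomPlanarGeometry.SAW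

namespace StripTM

/-! ### Boolean words -/

/-- All traces of length `n`. [folklore] -/
def bwords (n : ℕ) : Finset (List Bool) := (Finset.univ : Finset (Fin n → Bool)).image List.ofFn

/-- Membership in `bwords n` is having length `n`. [folklore] -/
@[simp] theorem mem_bwords {n : ℕ} {cs : List Bool} : cs ∈ bwords n ↔ cs.length = n := by
  simp only [bwords, Finset.mem_image, Finset.mem_univ, true_and]
  constructor
  · rintro ⟨f, rfl⟩; simp
  · intro h; subst h; exact ⟨fun i => cs[i], List.ofFn_getElem⟩

/-- `bwords (n+1)` by the last letter. [folklore] -/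
theorem bwords_succ (n : ℕ) :
    bwords (n + 1) = (bwords n).biUnion fun w => (univ : Finset Bool).image fun e => w ++ [e] := by
  ext w
  simp only [mem_bwords, mem_biUnion, mem_image, mem_univ, true_and]
  constructor
  · intro h
    refine ⟨w.take n, by simp [h], w[n]'(by omega), ?_⟩
    conv_rhs => rw [← List.take_append_drop n w]
    rw [List.drop_eq_getElem_cons (by omega), List.drop_of_length_le (by omega)]
  · rintro ⟨w', hw', e, rfl⟩; simp [hw']

/-- Last-letter decomposition of sums over traces. [folklore] -/
theorem sum_bwords_succ {M : Type*} [AddCommMonoid M] (n : ℕ) (f : List Bool → M) :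
    ∑ w ∈ bwords (n + 1), f w = ∑ w ∈ bwords n, ∑ e : Bool, f (w ++ [e]) := by
  rw [bwords_succ, sum_biUnion]
  · refine sum_congr rfl fun w _ => ?_
    rw [sum_image]
    intro d _ d' _ h
    simpa using List.append_cancel_left h
  · intro w _ w' _ hne
    simp only [Function.onFun]
    rw [Finset.disjoint_left]
    intro u hu hu'
    simp only [mem_image, mem_univ, true_and] at hu hu'
    obtain ⟨d, rfl⟩ := hu
    obtain ⟨d', h⟩ := hu'
    have := congrArg List.dropLast h
    simp only [List.dropLast_concat] at this
    exact hne this.symm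

variable (l r0 : ℕ)

/-! ### The target quantities -/

/-- The fugacity `5/13 = 1/2.6`. [folklore] -/
noncomputable def qf : ℝ := 5 / 13

/-- `X u σ`: total weight of the traces of length `u` whose run reaches `σ`. [folklore] -/
noncomputable def X (u : ℕ) (σ : State) : ℝ :=
  ∑ cs ∈ bwords u, if runT l r0 0 (initState l) cs = some σ then qf ^ cs.count true else 0

open Classical in
/-- The accepted traces of length `m + 1`. [folklore] -/
noncomputable def accLayer (m : ℕ) : Finset (List Bool) := (bwords (m + 1)).filter (Accepts l r0)

/-- The accepted traces of length `≤ N`. [folklore] -/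
noncomputable def accTraces (N : ℕ) : Finset (List Bool) := (Finset.range N).biUnion (accLayer l r0)

/-- The weight of the accepted traces of length `≤ N`, with the extra factor for the first step.
[folklore] -/
noncomputable def accSum (N : ℕ) : ℝ := ∑ m ∈ Finset.range N, ∑ t ∈ accLayer l r0 m, qf ^ (t.count true + 1)

variable {l r0}

/-- `qf` is in `[0, 1]`. [folklore] -/
theorem qf_nonneg : (0 : ℝ) ≤ qf := by rw [qf]; norm_num

/-- `qf ≤ 1`. [folklore] -/
theorem qf_le_one : qf ≤ (1 : ℝ) := by rw [qf]; norm_num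

/-- `X ≥ 0`. [folklore] -/
theorem X_nonneg (u : ℕ) (σ : State) : 0 ≤ X l r0 u σ :=
  sum_nonneg fun cs _ => by split_ifs; exact pow_nonneg qf_nonneg _; exact le_rfl

/-- Rounding down the fugacity factor. [folklore] -/
theorem fug_le (w : ℕ) : (fug w : ℝ) ≤ qf * w := by
  rw [fug, qf]
  calc ((w * 5 / 13 : ℕ) : ℝ) ≤ (w * 5 : ℕ) / 13 := Nat.cast_div_le
    _ = 5 / 13 * w := by push_cast; ring

/-! ### Semantics of one layer -/

/-- The weight after a choice. [folklore] -/
def wtN (w : ℕ) (e : Bool) : ℕ := if e then fug w else w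

/-- `addChoice`, first component. [folklore] -/
theorem addChoice_getD (u : ℕ) (σ : State) (w : ℕ) (e : Bool) (p : Std.HashMap State ℕ × ℕ) (σ' : State) :
    (addChoice l r0 u σ w e p).1.getD σ' 0 =
      p.1.getD σ' 0 + if step l r0 u σ e = .next σ' then wtN w e else 0 := by
  unfold addChoice
  cases hs : step l r0 u σ e with
  | dead => simp
  | complete => simp
  | next σ'' =>
    simp only [wtN]
    rw [Std.HashMap.getD_alter]
    by_cases h : σ'' = σ'
    · subst h; simp [Std.HashMap.getD_eq_getD_getElem?]
    · rw [if_neg (by simpa using h), if_neg (by intro e; exact h (Res.next.inj e))]; simp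

/-- `addChoice`, second component. [folklore] -/
theorem addChoice_snd (u : ℕ) (σ : State) (w : ℕ) (e : Bool) (p : Std.HashMap State ℕ × ℕ) :
    (addChoice l r0 u σ w e p).2 = p.2 + if step l r0 u σ e = .complete then fug (wtN w e) else 0 := by
  unfold addChoice
  cases hs : step l r0 u σ e with
  | dead => simp
  | complete => simp [wtN]
  | next σ'' => simp

/-- The contribution of an entry to the key `σ'` of the next layer. [folklore] -/
def contribN (l r0 u : ℕ) (σ : State) (w : ℕ) (σ' : State) : ℕ :=
  ∑ e : Bool, if step l r0 u σ e = .next σ' then wtN w e else 0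

/-- The contribution of an entry to the accumulator. [folklore] -/
def complN (l r0 u : ℕ) (σ : State) (w : ℕ) : ℕ :=
  ∑ e : Bool, if step l r0 u σ e = .complete then fug (wtN w e) else 0

/-- **Semantics of a layer**: per-key sums and the accumulator. [folklore] -/
theorem layerOfList_spec (u : ℕ) (es : List (State × ℕ)) (acc : ℕ) (σ' : State) :
    (layerOfList l r0 u es acc).1.getD σ' 0 = (es.map fun sw => contribN l r0 u sw.1 sw.2 σ').sum ∧
      (layerOfList l r0 u es acc).2 = acc + (es.map fun sw => complN l r0 u sw.1 sw.2).sum := by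
  unfold layerOfList
  suffices key : ∀ (p : Std.HashMap State ℕ × ℕ),
      (es.foldl (fun p sw => addChoice l r0 u sw.1 sw.2 true (addChoice l r0 u sw.1 sw.2 false p)) p).1.getD σ' 0 =
        p.1.getD σ' 0 + (es.map fun sw => contribN l r0 u sw.1 sw.2 σ').sum ∧
      (es.foldl (fun p sw => addChoice l r0 u sw.1 sw.2 true (addChoice l r0 u sw.1 sw.2 false p)) p).2 =
        p.2 + (es.map fun sw => complN l r0 u sw.1 sw.2).sum by
    have := key (Std.HashMap.emptyWithCapacity 4096, acc)
    rw [Std.HashMap.getD_emptyWithCapacity, zero_add] at this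
    exact this
  induction es with
  | nil => intro p; simp
  | cons sw es ih =>
    intro p
    rw [List.foldl_cons]
    obtain ⟨h1, h2⟩ := ih (addChoice l r0 u sw.1 sw.2 true (addChoice l r0 u sw.1 sw.2 false p))
    rw [h1, h2, addChoice_getD, addChoice_getD, addChoice_snd, addChoice_snd]
    simp only [List.map_cons, List.sum_cons, contribN, complN, Fintype.sum_bool]
    constructor <;> ring

/-- Peeling the last layer of `runFrom`. [folklore] -/
theorem runFrom_succ (u n : ℕ) (p : Std.HashMap State ℕ × ℕ) :
    runFrom l r0 u (n + 1) p = layer l r0 (u + n) (runFrom l r0 u n p) := by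
  induction n generalizing u p with
  | zero => rfl
  | succ n ih =>
    rw [runFrom, ih (u + 1) (layer l r0 u p), runFrom]
    congr 1; omega

/-! ### The invariant of the dynamic programme -/

/-- `X 0`. [folklore] -/
theorem X_zero (σ : State) : X l r0 0 σ = if σ = initState l then 1 else 0 := by
  rw [X]
  have : bwords 0 = {[]} := by ext w; simp [List.length_eq_zero_iff]
  rw [this, sum_singleton]
  simp only [runT, Option.some.injEq, List.count_nil, pow_zero]
  by_cases h : σ = initState l
  · subst h; simp
  · rw [if_neg (Ne.symm h), if_neg h]

/-- The run on a trace with one more letter. [folklore] -/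
theorem runT_snoc_eq_some_iff (cs : List Bool) (e : Bool) (σ' : State) :
    runT l r0 0 (initState l) (cs ++ [e]) = some σ' ↔
      ∃ σ, runT l r0 0 (initState l) cs = some σ ∧ step l r0 cs.length σ e = .next σ' := by
  rw [runT_append, zero_add]
  cases hr : runT l r0 0 (initState l) cs with
  | none => simp
  | some σ =>
    rw [Option.bind_some]
    cases hs : step l r0 cs.length σ e with
    | next σ'' =>
      simp only [runT, hs, Option.some.injEq]
      constructor
      · rintro rfl; exact ⟨σ, rfl, hs⟩
      · rintro ⟨σ₀, h₀, h₁⟩; cases h₀; rw [hs] at h₁; exact Res.next.inj h₁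
    | dead =>
      simp only [runT, hs]
      constructor
      · intro h; cases h
      · rintro ⟨σ₀, h₀, h₁⟩; cases h₀; rw [hs] at h₁; cases h₁
    | complete =>
      simp only [runT, hs]
      constructor
      · intro h; cases h
      · rintro ⟨σ₀, h₀, h₁⟩; cases h₀; rw [hs] at h₁; cases h₁

/-- `X (u+1)` by the last letter. [folklore] -/
theorem X_succ (u : ℕ) (σ' : State) :
    X l r0 (u + 1) σ' = ∑ cs ∈ bwords u, ∑ e : Bool,
      if (∃ σ, runT l r0 0 (initState l) cs = some σ ∧ step l r0 u σ e = .next σ') then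
        qf ^ (cs.count true + if e then 1 else 0) else 0 := by
  rw [X, sum_bwords_succ]
  refine sum_congr rfl fun cs hcs => sum_congr rfl fun e _ => ?_
  rw [mem_bwords] at hcs
  have hc : (cs ++ [e]).count true = cs.count true + if e then 1 else 0 := by
    rw [List.count_append]; cases e <;> rfl
  simp only [runT_snoc_eq_some_iff, hcs, hc]

/-- The accepted traces of length `u + 1`. [folklore] -/
theorem sum_accLayer (u : ℕ) :
    ∑ t ∈ accLayer l r0 u, qf ^ (t.count true + 1) = ∑ cs ∈ bwords u, ∑ e : Bool,
      if (∃ σ, runT l r0 0 (initState l) cs = some σ ∧ step l r0 u σ e = .complete) then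
        qf ^ (cs.count true + (if e then 1 else 0) + 1) else 0 := by
  classical
  rw [accLayer, sum_filter, sum_bwords_succ]
  refine sum_congr rfl fun cs hcs => sum_congr rfl fun e _ => ?_
  rw [mem_bwords] at hcs
  have hc : [e].count true = if e then 1 else 0 := by cases e <;> rfl
  have hiff : Accepts l r0 (cs ++ [e]) ↔ ∃ σ, runT l r0 0 (initState l) cs = some σ ∧ step l r0 u σ e = .complete := by
    constructor
    · rintro ⟨init, e', σ, h, hr, hs⟩
      obtain ⟨rfl, he⟩ := List.append_inj' h rfl
      simp only [List.cons.injEq, and_true] at he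
      subst he; rw [hcs] at hs; exact ⟨σ, hr, hs⟩
    · rintro ⟨σ, hr, hs⟩; exact ⟨cs, e, σ, rfl, hr, hcs ▸ hs⟩
  by_cases h : Accepts l r0 (cs ++ [e])
  · rw [if_pos h, if_pos (hiff.1 h), List.count_append, hc]
  · rw [if_neg h, if_neg (fun h' => h (hiff.2 h'))]

/-- **The invariant of the dynamic programme.** [cite: Jensen2004SAWLowerBounds, §2] -/
theorem dp_invariant (u : ℕ) :
    (∀ σ, (((runFrom l r0 0 u ((Std.HashMap.emptyWithCapacity 16).insert (initState l) SCALE, 0)).1.getD σ 0 : ℕ) : ℝ)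
        ≤ 2 ^ 64 * X l r0 u σ) ∧
    (((runFrom l r0 0 u ((Std.HashMap.emptyWithCapacity 16).insert (initState l) SCALE, 0)).2 : ℕ) : ℝ)
        ≤ 2 ^ 64 * accSum l r0 u := by
  induction u with
  | zero =>
    constructor
    · intro σ
      simp only [runFrom, X_zero]
      rw [Std.HashMap.getD_insert]
      by_cases h : σ = initState l
      · subst h; norm_num [SCALE]
      · rw [if_neg (by simpa using Ne.symm h), Std.HashMap.getD_emptyWithCapacity, if_neg h]; simp
    · simp [runFrom, accSum]
  | succ u ih =>
    obtain ⟨ih1, ih2⟩ := ih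
    set P := runFrom l r0 0 u ((Std.HashMap.emptyWithCapacity 16).insert (initState l) SCALE, 0) with hP
    rw [runFrom_succ, zero_add, ← hP]
    have hsem := fun σ' => layerOfList_spec (l := l) (r0 := r0) u P.1.toList P.2 σ'
    -- the entries of the old layer
    set es := P.1.toList with hes
    have hkeys : (es.map Prod.fst).Nodup := by
      rw [hes, Std.HashMap.map_fst_toList_eq_keys]; exact Std.HashMap.nodup_keys
    have hval : ∀ sw ∈ es, ((sw.2 : ℕ) : ℝ) ≤ 2 ^ 64 * X l r0 u sw.1 := by
      rintro ⟨σ, w⟩ hsw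
      have h1 : P.1[σ]? = some w := Std.HashMap.mem_toList_iff_getElem?_eq_some.1 hsw
      have h2 : P.1.getD σ 0 = w := by rw [Std.HashMap.getD_eq_getD_getElem?, h1]; rfl
      rw [← h2]; exact ih1 σ
    -- a list sum of a function of the key is a finset sum over the keys
    have hlist : ∀ g : State → ℝ, (es.map fun sw => g sw.1).sum = ∑ σ ∈ (es.map Prod.fst).toFinset, g σ := by
      intro g; rw [List.sum_toFinset _ hkeys, List.map_map]; rfl
    -- at most one key is the run of a given trace
    have hone : ∀ (cs : List Bool) (a : ℝ), 0 ≤ a →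
        ∑ σ ∈ (es.map Prod.fst).toFinset, (if runT l r0 0 (initState l) cs = some σ then a else 0) ≤ a := by
      intro cs a ha
      cases hr : runT l r0 0 (initState l) cs with
      | none => simp [ha]
      | some σ₀ =>
        simp only [Option.some.injEq]
        rw [show (fun σ => if σ₀ = σ then a else 0) = fun σ => if σ = σ₀ then a else 0 from
          funext fun σ => by simp only [eq_comm], Finset.sum_ite_eq']
        split_ifs; exact le_rfl; exact ha
    constructor
    · intro σ'
      rw [layer, (hsem σ').1]
      -- bound each entry
      have step1 : (((es.map fun sw => contribN l r0 u sw.1 sw.2 σ').sum : ℕ) : ℝ) ≤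
          (es.map fun sw => 2 ^ 64 * ∑ e : Bool,
            (if step l r0 u sw.1 e = .next σ' then qf ^ (if e then 1 else 0) else 0) * X l r0 u sw.1).sum := by
        rw [Nat.cast_list_sum, List.map_map]
        apply List.sum_le_sum
        rintro ⟨σ, w⟩ hsw
        have hw := hval _ hsw
        simp only [Function.comp_apply, contribN, Fintype.sum_bool, Nat.cast_add, wtN]
        simp only [Bool.false_eq_true, if_false, if_true, pow_one, pow_zero]
        have hX := X_nonneg (l := l) (r0 := r0) u σ
        have hf := fug_le w
        split_ifs <;> push_cast <;> nlinarith [hf, hX, hw, qf_nonneg]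
      refine le_trans step1 ?_
      rw [hlist (fun σ => 2 ^ 64 * ∑ e : Bool, (if step l r0 u σ e = .next σ' then qf ^ (if e then 1 else 0) else 0) * X l r0 u σ),
        ← mul_sum, X_succ]
      refine mul_le_mul_of_nonneg_left ?_ (by positivity)
      -- expand X and exchange the sums
      set K := (es.map Prod.fst).toFinset with hK
      set T : State → Bool → List Bool → ℝ := fun σ e cs =>
        (if step l r0 u σ e = .next σ' then qf ^ (if e then 1 else 0) else 0) *
          (if runT l r0 0 (initState l) cs = some σ then qf ^ cs.count true else 0) with hT
      have hex : ∑ σ ∈ K, ∑ e : Bool,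
          (if step l r0 u σ e = .next σ' then qf ^ (if e then 1 else 0) else 0) * X l r0 u σ =
          ∑ cs ∈ bwords u, ∑ e : Bool, ∑ σ ∈ K, T σ e cs := by
        have e0 : ∀ σ e, (if step l r0 u σ e = .next σ' then qf ^ (if e then 1 else 0) else 0) * X l r0 u σ =
            ∑ cs ∈ bwords u, T σ e cs := fun σ e => by rw [X, mul_sum]
        simp only [e0]
        have e1 : ∑ σ ∈ K, ∑ e : Bool, ∑ cs ∈ bwords u, T σ e cs = ∑ σ ∈ K, ∑ cs ∈ bwords u, ∑ e : Bool, T σ e cs :=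
          sum_congr rfl fun σ _ => sum_comm
        have e2 : ∑ σ ∈ K, ∑ cs ∈ bwords u, ∑ e : Bool, T σ e cs = ∑ cs ∈ bwords u, ∑ σ ∈ K, ∑ e : Bool, T σ e cs :=
          sum_comm
        have e3 : ∑ cs ∈ bwords u, ∑ σ ∈ K, ∑ e : Bool, T σ e cs = ∑ cs ∈ bwords u, ∑ e : Bool, ∑ σ ∈ K, T σ e cs :=
          sum_congr rfl fun cs _ => sum_comm
        rw [e1, e2, e3]
      rw [hex]
      simp only [hT]
      refine sum_le_sum fun cs _ => sum_le_sum fun e _ => ?_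
      -- at most one key matches the run of `cs`
      have key : ∀ σ, (if step l r0 u σ e = .next σ' then qf ^ (if e then 1 else 0) else 0) *
          (if runT l r0 0 (initState l) cs = some σ then qf ^ cs.count true else 0) =
          if runT l r0 0 (initState l) cs = some σ then
            (if (∃ σ₀, runT l r0 0 (initState l) cs = some σ₀ ∧ step l r0 u σ₀ e = .next σ') then
              qf ^ (cs.count true + if e then 1 else 0) else 0) else 0 := by
        intro σ
        by_cases hr : runT l r0 0 (initState l) cs = some σ
        · rw [if_pos hr, if_pos hr]
          by_cases hs : step l r0 u σ e = .next σ'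
          · rw [if_pos hs, if_pos (show ∃ σ₀, runT l r0 0 (initState l) cs = some σ₀ ∧ step l r0 u σ₀ e = .next σ' from ⟨σ, hr, hs⟩), pow_add, mul_comm]
          · rw [if_neg hs, zero_mul, if_neg]; rintro ⟨σ₀, h₀, h₁⟩
            rw [hr] at h₀; cases h₀; exact hs h₁
        · rw [if_neg hr, if_neg hr, mul_zero]
      simp only [key]
      exact hone cs _ (by split_ifs <;> first | exact pow_nonneg qf_nonneg _ | exact le_rfl)
    · rw [layer, (hsem (initState l)).2, Nat.cast_add, accSum, sum_range_succ, mul_add, ← accSum]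
      refine add_le_add ih2 ?_
      have step1 : (((es.map fun sw => complN l r0 u sw.1 sw.2).sum : ℕ) : ℝ) ≤
          (es.map fun sw => 2 ^ 64 * ∑ e : Bool,
            (if step l r0 u sw.1 e = .complete then qf ^ ((if e then 1 else 0) + 1) else 0) * X l r0 u sw.1).sum := by
        rw [Nat.cast_list_sum, List.map_map]
        apply List.sum_le_sum
        rintro ⟨σ, w⟩ hsw
        have hw := hval _ hsw
        simp only [Function.comp_apply, complN, Fintype.sum_bool, Nat.cast_add, wtN]
        simp only [Bool.false_eq_true, if_false, if_true, zero_add]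
        have hX := X_nonneg (l := l) (r0 := r0) u σ
        have hf := fug_le w
        have hf2 := fug_le (fug w)
        have hq := qf_nonneg
        split_ifs <;> push_cast <;> nlinarith [hf, hf2, hX, hw, hq, mul_nonneg hq hq, pow_two qf]
      refine le_trans step1 ?_
      rw [hlist (fun σ => 2 ^ 64 * ∑ e : Bool, (if step l r0 u σ e = .complete then qf ^ ((if e then 1 else 0) + 1) else 0) * X l r0 u σ),
        ← mul_sum, sum_accLayer]
      refine mul_le_mul_of_nonneg_left ?_ (by positivity)
      set K := (es.map Prod.fst).toFinset with hK
      set T : State → Bool → List Bool → ℝ := fun σ e cs =>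
        (if step l r0 u σ e = .complete then qf ^ ((if e then 1 else 0) + 1) else 0) *
          (if runT l r0 0 (initState l) cs = some σ then qf ^ cs.count true else 0) with hT
      have hex : ∑ σ ∈ K, ∑ e : Bool,
          (if step l r0 u σ e = .complete then qf ^ ((if e then 1 else 0) + 1) else 0) * X l r0 u σ =
          ∑ cs ∈ bwords u, ∑ e : Bool, ∑ σ ∈ K, T σ e cs := by
        have e0 : ∀ σ e, (if step l r0 u σ e = .complete then qf ^ ((if e then 1 else 0) + 1) else 0) * X l r0 u σ =
            ∑ cs ∈ bwords u, T σ e cs := fun σ e => by rw [X, mul_sum]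
        simp only [e0]
        have e1 : ∑ σ ∈ K, ∑ e : Bool, ∑ cs ∈ bwords u, T σ e cs = ∑ σ ∈ K, ∑ cs ∈ bwords u, ∑ e : Bool, T σ e cs :=
          sum_congr rfl fun σ _ => sum_comm
        have e2 : ∑ σ ∈ K, ∑ cs ∈ bwords u, ∑ e : Bool, T σ e cs = ∑ cs ∈ bwords u, ∑ σ ∈ K, ∑ e : Bool, T σ e cs :=
          sum_comm
        have e3 : ∑ cs ∈ bwords u, ∑ σ ∈ K, ∑ e : Bool, T σ e cs = ∑ cs ∈ bwords u, ∑ e : Bool, ∑ σ ∈ K, T σ e cs :=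
          sum_congr rfl fun cs _ => sum_comm
        rw [e1, e2, e3]
      rw [hex]
      simp only [hT]
      refine sum_le_sum fun cs _ => sum_le_sum fun e _ => ?_
      have key : ∀ σ, (if step l r0 u σ e = .complete then qf ^ ((if e then 1 else 0) + 1) else 0) *
          (if runT l r0 0 (initState l) cs = some σ then qf ^ cs.count true else 0) =
          if runT l r0 0 (initState l) cs = some σ then
            (if (∃ σ₀, runT l r0 0 (initState l) cs = some σ₀ ∧ step l r0 u σ₀ e = .complete) then
              qf ^ (cs.count true + (if e then 1 else 0) + 1) else 0) else 0 := by
        intro σ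
        by_cases hr : runT l r0 0 (initState l) cs = some σ
        · rw [if_pos hr, if_pos hr]
          by_cases hs : step l r0 u σ e = .complete
          · rw [if_pos hs, if_pos (show ∃ σ₀, runT l r0 0 (initState l) cs = some σ₀ ∧ step l r0 u σ₀ e = .complete from ⟨σ, hr, hs⟩)]
            ring
          · rw [if_neg hs, zero_mul, if_neg]; rintro ⟨σ₀, h₀, h₁⟩
            rw [hr] at h₀; cases h₀; exact hs h₁
        · rw [if_neg hr, if_neg hr, mul_zero]
      simp only [key]
      exact hone cs _ (by split_ifs <;> first | exact pow_nonneg qf_nonneg _ | exact le_rfl)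

/-- **`dp ≤ 2⁶⁴ · accSum`.** [cite: Jensen2004SAWLowerBounds, §2] -/
theorem dp_le_accSum (H : ℕ) : ((dp l H r0 : ℕ) : ℝ) ≤ 2 ^ 64 * accSum l r0 (2 * l * H) :=
  (dp_invariant (2 * l * H)).2

/-! ### The Kraft sum -/

/-- `edgesN` at full length is the number of `true` letters. [folklore] -/
theorem edgesN_length (cs : List Bool) : edgesN cs cs.length = cs.count true := by
  induction cs using List.reverseRecOn with
  | nil => simp [edgesN]
  | append_singleton cs e ih =>
    rw [List.count_append, ← ih, edgesN, edgesN, List.length_append, List.length_singleton,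
      Finset.range_add_one, Finset.filter_insert]
    have hc : [e].count true = if e then 1 else 0 := by cases e <;> rfl
    have hlast : (cs ++ [e]).getD cs.length false = e := by
      rw [List.getD_eq_getElem?_getD, List.getElem?_append_right le_rfl]; simp
    have hsame : (Finset.range cs.length).filter (fun u' => (cs ++ [e]).getD u' false = true) =
        (Finset.range cs.length).filter (fun u' => cs.getD u' false = true) := by
      refine Finset.filter_congr fun u' hu' => ?_
      rw [Finset.mem_range] at hu'
      rw [List.getD_eq_getElem?_getD, List.getD_eq_getElem?_getD, List.getElem?_append_left hu']
    rw [hlast, hsame]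
    cases e
    · simp
    · rw [if_pos rfl, Finset.card_insert_of_notMem (by simp), hc, if_pos rfl]

/-- **The Kraft sum of the decoded irreducible bridges dominates the weighted count.** For
`l ≥ 2`, there is a finite set `S` of irreducible bridges of span `l` (the decoded accepted traces)
with `dp l H r₀ / 2⁶⁴ ≤ Σ_{s ∈ S} (5/13)^{|s|}`. [cite: Jensen2004SAWLowerBounds, §2] -/
theorem kraft_ge (hl : 2 ≤ l) (H : ℕ) :
    ∃ S : Finset (List Step), (∀ s ∈ S, IsIrrBridge s ∧ xEnd s = l) ∧
      ((dp l H r0 : ℕ) : ℝ) / 2 ^ 64 ≤ ∑ s ∈ S, (5 / 13 : ℝ) ^ s.length := by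
  classical
  refine ⟨(accTraces l r0 (2 * l * H)).image (decode l r0), ?_, ?_⟩
  · intro s hs
    obtain ⟨t, ht, rfl⟩ := mem_image.1 hs
    rw [accTraces, mem_biUnion] at ht
    obtain ⟨m, -, ht⟩ := ht
    rw [accLayer, mem_filter] at ht
    have := decode_spec hl ht.2
    exact ⟨this.1, this.2.1⟩
  · rw [div_le_iff₀ (by positivity), mul_comm]
    refine le_trans (dp_le_accSum H) (mul_le_mul_of_nonneg_left ?_ (by positivity))
    have hacc : ∀ t ∈ accTraces l r0 (2 * l * H), Accepts l r0 t := by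
      intro t ht
      rw [accTraces, mem_biUnion] at ht
      obtain ⟨m, -, ht⟩ := ht
      rw [accLayer, mem_filter] at ht; exact ht.2
    rw [sum_image fun t ht t' ht' h => decode_inj hl (hacc t ht) (hacc t' ht') h]
    rw [accSum, accTraces, sum_biUnion]
    · refine sum_le_sum fun m _ => sum_le_sum fun t ht => ?_
      rw [accLayer, mem_filter] at ht
      have h3 := (decode_spec hl ht.2).2.2
      rw [edgesN_length] at h3
      rw [show qf = (5 / 13 : ℝ) from rfl]
      exact pow_le_pow_of_le_one (by norm_num) (by norm_num) h3
    · intro m _ m' _ hne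
      simp only [Function.onFun]
      rw [Finset.disjoint_left]
      intro t h1 h2
      rw [accLayer, mem_filter, mem_bwords] at h1 h2
      omega

end StripTM

end Literature.Probability.RandomPlanarGeometry.SAW
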